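import Summits.CriticalPhenomena.Ising3DConformalLimit.Theses.MoebiusRestrictionCurrents
import Summits.CriticalPhenomena.Ising3DConformalLimit.Theorems.MoebiusRestrictionCurrentsCruxesGiveTargetInversion

/-!
# Birth skeleton for crux `RemovalRatioInversion` (item `stmt-CriticalPhenomena-4855`)

Route `route-CriticalPhenomena-MoebiusRestrictionCurrents` (sub-problem `Ising3DConformalLimit`),
crux r3 `RemovalRatioInversion` (MÖBIUS-INVARIANT REMOVAL RATIOS): for every admissible open
`D ⊆ ℝ³` (open, Lebesgue-null frontier) with `0 ∉ D` and `x ≠ y` in `D`,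
`r_δ(ιD; ιx, ιy) − r_δ(D; x, y) → 0` as `δ → 0⁺`, where
`r_δ(D; x, y) = G^D_δ(x,y) / G^{ℝ³}_δ(x,y)` is the ratio of the free-b.c. critical two-point
function of the discretised domain `D_δ` to the full-space one and `ι` is the unit inversion.

## The line (birth certificate BC3; three registered stubs and a kernel-checked composition)

EXISTENCE / LOCALITY / CAVITY INVARIANCE.  Write `R(D; x, y)` for the continuum removal ratio
`lim_{δ→0⁺} r_δ(D; x, y)` and `A_n = {1/(n+1) < ‖z‖ < n+1}` for the spherical shells (`ι A_n = A_n`).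

* `stub_ratioLimitExists` (open; implied by the sibling crux `TwoPointDomainTheory`, item 4856,
  since `ρ₀²G^D_δ → H_D` and `ρ₀²G^{ℝ³}_δ → H_{ℝ³} > 0` give `r_δ → H_D/H_{ℝ³}`; strictly weaker:
  no renormalisation, no exponent): the removal ratio of every admissible domain converges,
  i.e. a continuum removal-ratio functional `R` exists.
* `stub_shellTruncation` (open, "locality": a shrinking hole at the origin and a receding outer
  cut are invisible in the limit): `R(D ∩ A_n; x, y) → R(D; x, y)` as `n → ∞` for admissible
  `D ∌ 0`.  At fixed `δ` this is GKS-II monotone convergence; the content is the exchange of the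
  `n`- and `δ`-limits (irrelevance of a point defect, `Δ_ε > 0`, and of the boundary at infinity).
* `stub_cavityInversion` (open, LOAD-BEARING — the BCFT prediction in its cleanest regime, both
  domains bounded and bounded away from `0` and `∞`): for admissible `D ∌ 0`, `x ≠ y` in `D ∩ A_n`,
  `R(ιD ∩ A_n; ιx, ιy) = R(D ∩ A_n; x, y)`; since `ιD ∩ A_n = ι(D ∩ A_n)` this is exactly inversion
  invariance of `R` on bounded admissible cavities with `0 ∉` closure (the regime of the route's
  numerics, Cosme–Lopes–Penedones 2015, and of its cheapest falsifier ball ↔ ball).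

Composition `RemovalRatioInversion_of`: admissibility of `ιD` is the PROVED tree lemma
`Theorems.MoebiusRestrictionCurrents.adm_image_inversion`; the two ratio limits exist (stub 1, for
`D` and for `ιD`); truncating both by `A_n` and letting `n → ∞` (stub 2, twice) along the eventual
equality of stub 3 (`x, y ∈ A_n` eventually) identifies them (`tendsto_nhds_unique`); the
difference of the lattice ratios then tends to `R − R = 0`.

No new definitions of mathematical objects beyond local abbreviations of the route's own
`let`-bound vocabulary (`Adm`, `G`, `ι`) and the shells; the restatement of the crux through this
vocabulary is definitional (`removalRatioInversion_iff` is `Iff.rfl`).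
-/

noncomputable section

namespace Summit.CriticalPhenomena.Ising3DConformalLimit.Cruxes.RemovalRatioInversion.Birth

open scoped BigOperators Topology Manifold Classical MeasureTheory ProbabilityTheory Matrix InnerProductSpace ComplexConjugate ContinuousMap
open Filter Set Function TopologicalSpace MeasureTheory
open Literature.Probability.LatticeModels

local notation "E" => EuclideanSpace ℝ (Fin 3)

/-! ### The route's vocabulary (verbatim copies of the `let`-bound terms of the crux) -/

/-- Admissible domains of the route: open with Lebesgue-null frontier (the crux's `Adm`). -/
def Adm (D : Set E) : Prop := IsOpen D ∧ MeasureTheory.volume (frontier D) = 0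

/-- The route's free-b.c. critical `n`-point function of the discretised domain `D_δ`
(the crux's `G`, verbatim). -/
def G (D : Set E) (δ : ℝ) (n : ℕ) (x : Fin n → E) : ℝ :=
  limUnder Filter.atTop (fun Lb : ℕ => Literature.Probability.LatticeModels.isingExpect (Literature.Probability.LatticeModels.zdGraph 3) ((Literature.Probability.LatticeModels.box 3 Lb).filter (fun z => z ∈ Literature.Probability.LatticeModels.latticeApprox δ '' D)) (Literature.Probability.LatticeModels.criticalBeta 3) 0 Literature.Probability.LatticeModels.BoundaryCondition.free (Literature.Probability.LatticeModels.spinMonomial (fun i => Literature.Probability.LatticeModels.latticeApprox δ (x i))))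

/-- The unit inversion `ι(z) = z/‖z‖²` about the origin (the crux's `ι`). -/
def ι : E → E := EuclideanGeometry.inversion (0 : E) 1

/-- Removal ratio `r_δ(D; x, y) = G^D_δ(x,y) / G^{ℝ³}_δ(x,y)`. -/
def removalRatio (D : Set E) (δ : ℝ) (x y : E) : ℝ := G D δ 2 ![x, y] / G Set.univ δ 2 ![x, y]

/-- Spherical shell `A_n = {1/(n+1) < ‖z‖ < n+1}`; `ι A_n = A_n`, `⋃ A_n = ℝ³ ∖ {0}`. -/
def shell (n : ℕ) : Set E := {z | 1 / ((n : ℝ) + 1) < ‖z‖ ∧ ‖z‖ < (n : ℝ) + 1}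

/-- `R` is a continuum removal-ratio functional: on every admissible domain the lattice removal
ratio converges to it as `δ → 0⁺`. (Limits along `𝓝[>] 0` are unique, so `R D x y` is pinned for
admissible `D` and `x ≠ y` in `D`; elsewhere it is unconstrained.) -/
def IsRatioLimit (R : Set E → E → E → ℝ) : Prop :=
  ∀ D : Set E, Adm D → ∀ x y : E, x ∈ D → y ∈ D → x ≠ y →
    Tendsto (fun δ : ℝ => removalRatio D δ x y) (𝓝[>] (0 : ℝ)) (𝓝 (R D x y))

/-- The crux, read through the local vocabulary, is DEFINITIONALLY the route decl. -/
theorem removalRatioInversion_iff :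
    Summit.CriticalPhenomena.Ising3DConformalLimit.Theses.MoebiusRestrictionCurrents.RemovalRatioInversion ↔
    (∀ D : Set E, Adm D → (0 : E) ∉ D → ∀ x y : E, x ∈ D → y ∈ D → x ≠ y →
      Tendsto (fun δ : ℝ => removalRatio (ι '' D) δ (ι x) (ι y) - removalRatio D δ x y)
        (𝓝[>] (0 : ℝ)) (𝓝 0)) :=
  Iff.rfl

/-! ### Statements of the three stubs -/

/-- Statement of STUB 1 (existence of the continuum removal ratio). -/
def RatioLimitExists : Prop := ∃ R : Set E → E → E → ℝ, IsRatioLimit R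

/-- Statement of STUB 2 (shell-truncation continuity / locality of the removal ratio). -/
def ShellTruncation : Prop :=
  ∀ R : Set E → E → E → ℝ, IsRatioLimit R → ∀ D : Set E, Adm D → (0 : E) ∉ D →
    ∀ x y : E, x ∈ D → y ∈ D → x ≠ y →
      Tendsto (fun n : ℕ => R (D ∩ shell n) x y) atTop (𝓝 (R D x y))

/-- Statement of STUB 3 (inversion invariance of the removal ratio of truncated cavities). -/
def CavityInversion : Prop :=
  ∀ R : Set E → E → E → ℝ, IsRatioLimit R → ∀ D : Set E, Adm D → (0 : E) ∉ D →
    ∀ x y : E, x ∈ D → y ∈ D → x ≠ y → ∀ n : ℕ, x ∈ shell n → y ∈ shell n →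
      R (ι '' D ∩ shell n) (ι x) (ι y) = R (D ∩ shell n) x y

/-! ### The registered stubs (all three carry `sorry`) -/

/-- STUB 1 (open; L) — `RatioLimitExists`: there is `R` with `r_δ(D; x, y) → R(D; x, y)` as
`δ → 0⁺` for every admissible `D` and `x ≠ y` in `D`.  Follows from the sibling crux
`TwoPointDomainTheory` (item 4856): `ρ₀(δ)²G^D_δ → H_D` locally uniformly and
`ρ₀(δ)²G^{ℝ³}_δ → H_{ℝ³} > 0`, so the `ρ₀`-free ratio tends to `H_D/H_{ℝ³}`; it is strictly weaker
(no renormalisation, no exponent, ratios are GKS-bounded in `[0,1]`: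
`isingCorr_free_le_of_subset`, positivity of the full-space function via `FreeIsCritical` and
`criticalTwoPoint_bounds_holds`).  Degenerate admissible domains are consistent: co-null `D`
discretise to all of `ℤ³` (ratio `≡ 1`), disconnected `D_δ` give ratio `≡ 0`.
[DuminilCopinICM2022 §8.4; ChelkakHonglerIzyurov2021 Thm 1.3 (planar analogue, free b.c.)] -/
theorem stub_ratioLimitExists : ∃ R : Set E → E → E → ℝ, IsRatioLimit R := by
  sorry

/-- STUB 2 (open; L) — `ShellTruncation`: for a removal-ratio functional `R`, admissible `D ∌ 0`
and `x ≠ y` in `D`, `R(D ∩ A_n; x, y) → R(D; x, y)` (`A_n = {1/(n+1) < ‖z‖ < n+1}`; `D ∩ A_n` is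
admissible and contains `x, y` for large `n`, so both sides are pinned).  At fixed `δ`,
`r_δ(D ∩ A_n) ↑ r_δ(D)` by GKS-II (fewer couplings under free b.c.; the box limit and the `n`-limit
commute by monotonicity); the content is uniformity in `δ`: a hole of radius `1/(n+1)` at the
origin (a point defect; expected effect `O(n^{-Δ_ε})`, `Δ_ε ≈ 1.41`) and an outer free boundary
at distance `n+1` (expected effect polynomially small by one-arm decay of the sourced cluster) do
not change the ratio in the limit.  Why it might fail: relative (not absolute) control is needed,
`G^{ℝ³}_δ(x,y) → 0` like `δ^{1+η}`.  [AizenmanDuminilCopinSidoravicius2015 §1 (GKS/currents);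
Cardy1996 §7 (ordinary transition); BurkhardtEisenriegler1995 (small-sphere expansion)] -/
theorem stub_shellTruncation :
    ∀ R : Set E → E → E → ℝ, IsRatioLimit R → ∀ D : Set E, Adm D → (0 : E) ∉ D →
      ∀ x y : E, x ∈ D → y ∈ D → x ≠ y →
        Tendsto (fun n : ℕ => R (D ∩ shell n) x y) atTop (𝓝 (R D x y)) := by
  sorry

/-- STUB 3 (open; XL, LOAD-BEARING) — `CavityInversion`: for a removal-ratio functional `R`,
admissible `D ∌ 0`, `x ≠ y` in `D ∩ A_n`: `R(ιD ∩ A_n; ιx, ιy) = R(D ∩ A_n; x, y)`.  Since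
`ι A_n = A_n`, `ιD ∩ A_n = ι(D ∩ A_n)`, so this is inversion INVARIANCE of the continuum removal
ratio on bounded admissible cavities whose closure avoids `0` — a class stable under `ι`, with no
point at infinity involved; the lattice form of "free b.c. of every such cavity renormalise to the
conformally invariant ordinary boundary condition" (the ratio `H_D/H_{ℝ³}` is a Möbius scalar
when `H` is covariant).  Tested numerically only for balls (Cosme–Lopes–Penedones 2015 §3–4);
why it might fail: edges/cusps/fractal null frontiers may carry non-conformal surface data
(scale-invariant b.c. need not be conformal, arXiv:1210.6439 §3).
[CosmeLopesPenedones2015; Cardy1996 §7.2–7.3; BurkhardtEisenriegler1995; arXiv:1210.6439] -/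
theorem stub_cavityInversion :
    ∀ R : Set E → E → E → ℝ, IsRatioLimit R → ∀ D : Set E, Adm D → (0 : E) ∉ D →
      ∀ x y : E, x ∈ D → y ∈ D → x ≠ y → ∀ n : ℕ, x ∈ shell n → y ∈ shell n →
        R (ι '' D ∩ shell n) (ι x) (ι y) = R (D ∩ shell n) x y := by
  sorry

/-- The inline signature of stub 1 is the named statement. -/
theorem ratioLimitExists_holds : RatioLimitExists := stub_ratioLimitExists
/-- The inline signature of stub 2 is the named statement. -/
theorem shellTruncation_holds : ShellTruncation := stub_shellTruncation
/-- The inline signature of stub 3 is the named statement. -/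
theorem cavityInversion_holds : CavityInversion := stub_cavityInversion

/-! ### Name-keyed aliases of the statements (the hypotheses of the composition) -/
namespace Registered

/-- Alias of `RatioLimitExists` keyed by the registered stub name. -/
abbrev stub_ratioLimitExists : Prop := RatioLimitExists
/-- Alias of `ShellTruncation` keyed by the registered stub name. -/
abbrev stub_shellTruncation : Prop := ShellTruncation
/-- Alias of `CavityInversion` keyed by the registered stub name. -/
abbrev stub_cavityInversion : Prop := CavityInversion

end Registered

/-! ### Elementary geometry used by the composition (proved) -/

/-- Every nonzero point lies in the shells `A_n` for all large `n`. [folklore] -/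
theorem eventually_mem_shell {z : E} (hz : z ≠ 0) : ∀ᶠ n : ℕ in atTop, z ∈ shell n := by
  have hpos : 0 < ‖z‖ := norm_pos_iff.mpr hz
  obtain ⟨N, hN⟩ := exists_nat_gt (max ‖z‖ ‖z‖⁻¹)
  filter_upwards [eventually_ge_atTop N] with n hn
  have hn' : (N : ℝ) ≤ n := Nat.cast_le.mpr hn
  have hlt : max ‖z‖ ‖z‖⁻¹ < (n : ℝ) + 1 := by linarith
  have hn1 : (0 : ℝ) < (n : ℝ) + 1 := by positivity
  refine ⟨?_, lt_of_le_of_lt (le_max_left _ _) hlt⟩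
  have h : ‖z‖⁻¹ < (n : ℝ) + 1 := lt_of_le_of_lt (le_max_right _ _) hlt
  have h2 : ‖z‖ * ‖z‖⁻¹ < ‖z‖ * ((n : ℝ) + 1) := mul_lt_mul_of_pos_left h hpos
  rw [mul_inv_cancel₀ hpos.ne'] at h2
  rw [div_lt_iff₀ hn1]
  exact h2

/-- The unit inversion preserves admissibility of domains avoiding the origin — the PROVED tree
lemma `Theorems.MoebiusRestrictionCurrents.adm_image_inversion` specialised to `ℝ³`, Lebesgue
measure, centre `0`, radius `1`. -/
theorem adm_image_ι {D : Set E} (hD : Adm D) (h0 : (0 : E) ∉ D) : Adm (ι '' D) :=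
  Summit.CriticalPhenomena.Ising3DConformalLimit.Theorems.MoebiusRestrictionCurrents.adm_image_inversion
    volume (0 : E) one_ne_zero hD h0

/-- The image of a domain avoiding the origin avoids the origin. [folklore] -/
theorem zero_not_mem_image_ι {D : Set E} (h0 : (0 : E) ∉ D) : (0 : E) ∉ ι '' D := by
  rintro ⟨z, hz, hz0⟩
  have hz' : z = 0 := (EuclideanGeometry.inversion_eq_center one_ne_zero).1 hz0
  exact h0 (hz' ▸ hz)

/-! ### The composition: the three stubs imply the crux, by name (real proof, no `sorry`) -/

/-- `RemovalRatioInversion` from the stubs.  For admissible `D ∌ 0` and `x ≠ y` in `D`: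
`ιD` is admissible (tree lemma), `ιx ≠ ιy` lie in `ιD ∌ 0`; by stub 1 the ratios `r_δ(D; x, y)`
and `r_δ(ιD; ιx, ιy)` converge to `R(D; x, y)` and `R(ιD; ιx, ιy)`; by stub 2 (for `D` and for
`ιD`) these are the limits of `R(D ∩ A_n; x, y)` and `R(ιD ∩ A_n; ιx, ιy)`, which agree for all
large `n` by stub 3 (`x, y ∈ A_n` eventually), hence are equal (`tendsto_nhds_unique`); so the
difference of the lattice ratios tends to `0`. -/
theorem RemovalRatioInversion_of (hEx : Registered.stub_ratioLimitExists)
    (hTrunc : Registered.stub_shellTruncation) (hCav : Registered.stub_cavityInversion) :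
    Summit.CriticalPhenomena.Ising3DConformalLimit.Theses.MoebiusRestrictionCurrents.RemovalRatioInversion := by
  obtain ⟨R, hR⟩ := hEx
  rw [removalRatioInversion_iff]
  intro D hD h0 x y hx hy hxy
  -- geometry of the inverted configuration
  have hιD : Adm (ι '' D) := adm_image_ι hD h0
  have h0' : (0 : E) ∉ ι '' D := zero_not_mem_image_ι h0
  have hx' : ι x ∈ ι '' D := mem_image_of_mem ι hx
  have hy' : ι y ∈ ι '' D := mem_image_of_mem ι hy
  have hxy' : ι x ≠ ι y := (EuclideanGeometry.inversion_injective (0 : E) one_ne_zero).ne hxy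
  have hx0 : x ≠ 0 := fun h => h0 (h ▸ hx)
  have hy0 : y ≠ 0 := fun h => h0 (h ▸ hy)
  -- stub 1: both ratio limits exist
  have h1 : Tendsto (fun δ : ℝ => removalRatio D δ x y) (𝓝[>] (0 : ℝ)) (𝓝 (R D x y)) :=
    hR D hD x y hx hy hxy
  have h2 : Tendsto (fun δ : ℝ => removalRatio (ι '' D) δ (ι x) (ι y)) (𝓝[>] (0 : ℝ))
      (𝓝 (R (ι '' D) (ι x) (ι y))) :=
    hR (ι '' D) hιD (ι x) (ι y) hx' hy' hxy'
  -- stub 2: both limits are limits of truncated-cavity ratios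
  have hT1 : Tendsto (fun n : ℕ => R (D ∩ shell n) x y) atTop (𝓝 (R D x y)) :=
    hTrunc R hR D hD h0 x y hx hy hxy
  have hT2 : Tendsto (fun n : ℕ => R (ι '' D ∩ shell n) (ι x) (ι y)) atTop
      (𝓝 (R (ι '' D) (ι x) (ι y))) :=
    hTrunc R hR (ι '' D) hιD h0' (ι x) (ι y) hx' hy' hxy'
  -- stub 3: the truncated ratios agree for all large `n`
  have hev : (fun n : ℕ => R (ι '' D ∩ shell n) (ι x) (ι y)) =ᶠ[atTop]
      (fun n : ℕ => R (D ∩ shell n) x y) := by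
    filter_upwards [eventually_mem_shell hx0, eventually_mem_shell hy0] with n hxn hyn
    exact hCav R hR D hD h0 x y hx hy hxy n hxn hyn
  have hEq : R (ι '' D) (ι x) (ι y) = R D x y := tendsto_nhds_unique (hT2.congr' hev) hT1
  -- conclusion
  have h3 := h2.sub h1
  rw [hEq, sub_self] at h3
  exact h3

end Summit.CriticalPhenomena.Ising3DConformalLimit.Cruxes.RemovalRatioInversion.Birth
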